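import Summits.KontsevichZagierPeriods.KontsevichZagierPeriods.Theorems.LinRedNormalFormArrangementNormalFormStubRebaseSimpleZeroManyChainBlocks

/-!
# Stub `stub_rebaseSimpleZeroMany`, part `rebaseSimpleZeroMany_common` (crux `ArrangementNormalForm`,
line `janus-bands`) — brick `ChainJanusCells`

The JANUS CELLS of a clean chain `A < t₀ < ⋯ < tₙ < B` of `n + 1` fibres over a one-dimensional
base with respect to a constant section `T₀ ≤ A ≤ B`: the block domains
`RebaseChain.jDom M c T₀ A B rU rV` (cut links `c`; the bottoms switch from `T₀` to `A` at the
fibre `rU`, the tops from `A` to `B` at the fibre `rV`). Geometry of the position dissection used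
by the sub-section Janus (brick `ChainSubJanus`) and by the separable cut (brick `ChainGrid`):
all cells lie in the box `{T₀ < tₗ < B}` (`jDom_subset_box`); the pinched cell `jDom c r r` is
the unpinched cell `jDom c (n + 1) r` cut by `A < tᵣ` (`mem_jDom_iff`); the deeper cells
`jDom (c ∪ {r' − 1}) r' r'`, `r < r' ≤ n + 1`, lie in the unpinched cell (`piece_subset_top`),
cover it together with the pinched cell up to the null ties `tₗ = A` (`mem_cover`) and are
pairwise disjoint (`not_mem_piece_of_mem`, `not_mem_piece_piece`).
Registered: `rebaseSimpleZeroMany_janusCover`.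

References: M. Kontsevich, D. Zagier, *Periods* (2001), §1.2, rule (1a).
-/

noncomputable section

open Set MeasureTheory MvPolynomial
open Literature.NumberTheory.Transcendental Literature.ModelTheory.ExponentialFields

namespace Summit.KontsevichZagierPeriods.ArrangementNormalForm.JanusBands

namespace RebaseChain

open SeparatePos RebasePos RebaseZero RebaseNest

variable {n m' : ℕ}

/-! ### The Janus cells -/

/-- Bottoms of the Janus blocks: `T₀` below the fibre `r`, `A` from `r` on. -/
def jU (T₀ A : Cf) (r : ℕ) : Fin (n + 1) → Cf := fun l => if (l : ℕ) < r then T₀ else A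

/-- Tops of the Janus blocks: `A` below the fibre `r`, `B` from `r` on. -/
def jV (A Bd : Cf) (r : ℕ) : Fin (n + 1) → Cf := fun l => if (l : ℕ) < r then A else Bd

/-- A bottom below the threshold. -/
theorem jU_of_lt {T₀ A : Cf} {r : ℕ} {l : Fin (n + 1)} (h : (l : ℕ) < r) : jU T₀ A r l = T₀ := if_pos h

/-- A bottom from the threshold on. -/
theorem jU_of_le {T₀ A : Cf} {r : ℕ} {l : Fin (n + 1)} (h : r ≤ (l : ℕ)) : jU T₀ A r l = A :=
  if_neg (not_lt.2 h)

/-- A top below the threshold. -/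
theorem jV_of_lt {A Bd : Cf} {r : ℕ} {l : Fin (n + 1)} (h : (l : ℕ) < r) : jV A Bd r l = A := if_pos h

/-- A top from the threshold on. -/
theorem jV_of_le {A Bd : Cf} {r : ℕ} {l : Fin (n + 1)} (h : r ≤ (l : ℕ)) : jV A Bd r l = Bd :=
  if_neg (not_lt.2 h)

/-- The JANUS CELL with cut links `c`, bottoms switching at `rU` and tops switching at `rV`. -/
def jDom (M : Fin m' → Cf) (c : Finset ℕ) (T₀ A Bd : Cf) (rU rV : ℕ) : Set (Fin (0 + 1 + (n + 1)) → ℝ) :=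
  gDom 0 (n + 1) m' M (blo c (jU T₀ A rU)) (bhi c (jV A Bd rV))

/-- The clean chain `A < t₀ < ⋯ < tₙ < B` is the Janus cell `jDom ∅ 0 0`. -/
theorem chain_eq_jDom (M : Fin m' → Cf) (T₀ A Bd : Cf) :
    gDom 0 (n + 1) m' M (clo A) (chi Bd) = jDom M ∅ T₀ A Bd 0 0 := by
  rw [jDom, clo_eq_blo, chi_eq_bhi]
  rfl

variable {M : Fin m' → Cf} {T₀ A Bd : Cf}

/-- Janus cells lie in the box `{T₀ < tₗ < B}` (given `T₀ ≤ A ≤ B` on the base cell). -/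
theorem jDom_subset_box (hTA : ∀ y ∈ cell M, ev T₀ y ≤ ev A y) (hAB : ∀ y ∈ cell M, ev A y ≤ ev Bd y)
    (c : Finset ℕ) (rU rV : ℕ) : jDom (n := n) M c T₀ A Bd rU rV ⊆ pDom M (fun _ => T₀) fun _ => Bd := by
  intro z hz
  have hy : yv z ∈ cell M := ((mem_bdom M c _ _ z).1 hz).1
  refine (mem_pDom M _ _ z).2 ⟨hy, fun l => ⟨barrier_lo hz (fun l' => ?_) l, barrier_hi hz (fun l' => ?_) l⟩⟩
  · by_cases h : (l' : ℕ) < rU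
    · rw [jU_of_lt h]
    · rw [jU_of_le (not_lt.1 h)]; exact hTA _ hy
  · by_cases h : (l' : ℕ) < rV
    · rw [jV_of_lt h]; exact hAB _ hy
    · rw [jV_of_le (not_lt.1 h)]

/-- **The pinched cell inside the unpinched one.** If all cut links lie below the fibre `r ≤ n`
and the link just below `r` is cut, `jDom c r r = jDom c (n + 1) r ∩ {A < tᵣ}` (given `T₀ ≤ A`). -/
theorem mem_jDom_iff (hTA : ∀ y ∈ cell M, ev T₀ y ≤ ev A y) {c : Finset ℕ} {r : ℕ} (hr : r < n + 1)
    (hc : ∀ j ∈ c, j < r) (hcr : ∀ j : Fin n, (j : ℕ) + 1 = r → (j : ℕ) ∈ c)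
    (z : Fin (0 + 1 + (n + 1)) → ℝ) :
    z ∈ jDom M c T₀ A Bd r r ↔ z ∈ jDom M c T₀ A Bd (n + 1) r ∧ ev A (yv z) < tv z ⟨r, hr⟩ := by
  rw [jDom, jDom, mem_bdom, mem_bdom]
  have hU' : ∀ l : Fin (n + 1), jU T₀ A (n + 1) l = T₀ := fun l => jU_of_lt l.isLt
  simp only [hU']
  constructor
  · rintro ⟨hy, h0, hn, h⟩
    have hle := hTA _ hy
    refine ⟨⟨hy, ?_, hn, fun j => ⟨fun hj => ⟨((h j).1 hj).1, ?_⟩, (h j).2⟩⟩, ?_⟩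
    · by_cases h0r : (0 : ℕ) < r
      · rwa [jU_of_lt (show ((0 : Fin (n + 1)) : ℕ) < r from h0r)] at h0
      · rw [jU_of_le (show r ≤ ((0 : Fin (n + 1)) : ℕ) from not_lt.1 h0r)] at h0
        exact hle.trans_lt h0
    · have h2 := ((h j).1 hj).2
      by_cases hjr : ((j.succ : Fin (n + 1)) : ℕ) < r
      · rwa [jU_of_lt hjr] at h2
      · rw [jU_of_le (not_lt.1 hjr)] at h2
        exact hle.trans_lt h2
    · rcases Nat.eq_zero_or_pos r with hr0 | hr0
      · subst hr0
        rw [jU_of_le (Nat.zero_le _)] at h0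
        have e : (⟨0, hr⟩ : Fin (n + 1)) = 0 := Fin.ext (by simp)
        rw [e]; exact h0
      · have hjn : r - 1 < n := by omega
        set j : Fin n := ⟨r - 1, hjn⟩ with hjdef
        have hj : (j : ℕ) + 1 = r := by rw [hjdef]; dsimp only; omega
        have h2 := ((h j).1 (hcr j hj)).2
        rw [jU_of_le (r := r) (l := j.succ) (by rw [Fin.val_succ]; omega)] at h2
        have : (j.succ : Fin (n + 1)) = ⟨r, hr⟩ := Fin.ext (by rw [Fin.val_succ]; exact hj)
        rwa [this] at h2
  · rintro ⟨⟨hy, h0, hn, h⟩, hA⟩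
    refine ⟨hy, ?_, hn, fun j => ⟨fun hj => ⟨((h j).1 hj).1, ?_⟩, (h j).2⟩⟩
    · by_cases h0r : (0 : ℕ) < r
      · rwa [jU_of_lt (show ((0 : Fin (n + 1)) : ℕ) < r from h0r)]
      · rw [jU_of_le (show r ≤ ((0 : Fin (n + 1)) : ℕ) from not_lt.1 h0r)]
        have : (⟨r, hr⟩ : Fin (n + 1)) = 0 := Fin.ext (by simp only [Fin.val_zero]; omega)
        rwa [this] at hA
    · by_cases hjr : ((j.succ : Fin (n + 1)) : ℕ) < r
      · rw [jU_of_lt hjr]; exact ((h j).1 hj).2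
      · rw [jU_of_le (not_lt.1 hjr)]
        have h1 := hc _ hj
        have hj' : (j : ℕ) + 1 = r := by rw [Fin.val_succ] at hjr; omega
        have : (j.succ : Fin (n + 1)) = ⟨r, hr⟩ := Fin.ext (by rw [Fin.val_succ]; exact hj')
        rwa [this]

/-- **A deeper cell inside the unpinched one.** For `r < r'`, the Janus cell with the extra cut
below `r'` lies in `jDom c (n + 1) r` (given `T₀ ≤ A ≤ B`, all cuts of `c` below `r`). -/
theorem piece_subset_top (hAB : ∀ y ∈ cell M, ev A y ≤ ev Bd y)
    {c : Finset ℕ} {r : ℕ} (hr : r < n + 1) (hc : ∀ j ∈ c, j < r) {r' : ℕ} (hrr' : r < r') :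
    jDom (n := n) M (insert (r' - 1) c) T₀ A Bd r' r' ⊆ jDom M c T₀ A Bd (n + 1) r := by
  intro z hz
  rw [jDom, mem_bdom] at hz ⊢
  obtain ⟨hy, h0, hn, h⟩ := hz
  refine ⟨hy, ?_, ?_, fun j => ⟨fun hj => ?_, fun hj => ?_⟩⟩
  · rw [jU_of_lt (show ((0 : Fin (n + 1)) : ℕ) < n + 1 from Nat.succ_pos n)]
    rw [jU_of_lt (show ((0 : Fin (n + 1)) : ℕ) < r' by simp only [Fin.val_zero]; omega)] at h0
    exact h0
  · rw [jV_of_le (show r ≤ ((Fin.last n : Fin (n + 1)) : ℕ) by rw [Fin.val_last]; omega)]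
    by_cases hn' : ((Fin.last n : Fin (n + 1)) : ℕ) < r'
    · rw [jV_of_lt hn'] at hn; exact hn.trans_le (hAB _ hy)
    · rw [jV_of_le (not_lt.1 hn')] at hn; exact hn
  · have hjr : (j : ℕ) < r := hc _ hj
    obtain ⟨h1, h2⟩ := (h j).1 (Finset.mem_insert_of_mem hj)
    rw [jV_of_lt (show ((j.castSucc : Fin (n + 1)) : ℕ) < r' by rw [Fin.val_castSucc]; omega)] at h1
    rw [jU_of_lt (show ((j.succ : Fin (n + 1)) : ℕ) < r' by rw [Fin.val_succ]; omega)] at h2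
    rw [jV_of_lt (show ((j.castSucc : Fin (n + 1)) : ℕ) < r by rw [Fin.val_castSucc]; exact hjr),
      jU_of_lt (j.succ).isLt]
    exact ⟨h1, h2⟩
  · by_cases hjq : (j : ℕ) = r' - 1
    · obtain ⟨h1, h2⟩ := (h j).1 (by rw [hjq]; exact Finset.mem_insert_self _ _)
      rw [jV_of_lt (show ((j.castSucc : Fin (n + 1)) : ℕ) < r' by rw [Fin.val_castSucc]; omega)] at h1
      rw [jU_of_le (show r' ≤ ((j.succ : Fin (n + 1)) : ℕ) by rw [Fin.val_succ]; omega)] at h2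
      exact h1.trans h2
    · exact (h j).2 fun hh => (Finset.mem_insert.1 hh).elim hjq hj

/-- **The last fibre below `A` in a deeper cell**: in the cell with the extra cut below
`r' ≥ 1`, the fibre `r' − 1` lies below `A`. -/
theorem lt_A_of_mem_piece {c : Finset ℕ} {r' : ℕ} (h1 : 1 ≤ r') (hr' : r' ≤ n + 1)
    {z : Fin (0 + 1 + (n + 1)) → ℝ} (hz : z ∈ jDom M (insert (r' - 1) c) T₀ A Bd r' r') :
    tv z ⟨r' - 1, by omega⟩ < ev A (yv z) := by
  rw [jDom, mem_bdom] at hz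
  obtain ⟨-, -, hn, h⟩ := hz
  rcases Nat.lt_or_ge (r' - 1) n with hlt | hge
  · set j : Fin n := ⟨r' - 1, hlt⟩ with hj
    have hjv : (j : ℕ) = r' - 1 := rfl
    have := ((h j).1 (Finset.mem_insert_self _ _)).1
    rwa [jV_of_lt (show ((j.castSucc : Fin (n + 1)) : ℕ) < r' by rw [Fin.val_castSucc, hjv]; omega)] at this
  · have hq : r' - 1 = n := by omega
    rw [jV_of_lt (show ((Fin.last n : Fin (n + 1)) : ℕ) < r' by rw [Fin.val_last]; omega)] at hn
    have : (⟨r' - 1, by omega⟩ : Fin (n + 1)) = Fin.last n := Fin.ext (by rw [Fin.val_last]; exact hq)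
    rwa [this]

/-- **The position cells cover the unpinched cell** up to the ties `tₗ = A`: a point of
`jDom c (n + 1) r` no fibre of which sits at the level `A` lies in the pinched cell or in one of
the deeper cells. -/
theorem mem_cover (hTA : ∀ y ∈ cell M, ev T₀ y ≤ ev A y) {c : Finset ℕ} {r : ℕ} (hr : r < n + 1)
    (hc : ∀ j ∈ c, j < r) (hcr : ∀ j : Fin n, (j : ℕ) + 1 = r → (j : ℕ) ∈ c)
    {z : Fin (0 + 1 + (n + 1)) → ℝ} (hz : z ∈ jDom M c T₀ A Bd (n + 1) r)
    (hne : ∀ l, tv z l ≠ ev A (yv z)) :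
    z ∈ jDom M c T₀ A Bd r r ∨ ∃ r', r < r' ∧ r' ≤ n + 1 ∧ z ∈ jDom M (insert (r' - 1) c) T₀ A Bd r' r' := by
  classical
  rcases lt_or_gt_of_ne (hne ⟨r, hr⟩) with hlt | hgt
  swap
  · exact Or.inl ((mem_jDom_iff hTA hr hc hcr z).2 ⟨hz, hgt⟩)
  right
  -- the last fibre `q ≥ r` below `A`
  set S₀ : Finset (Fin (n + 1)) := Finset.univ.filter fun l => r ≤ (l : ℕ) ∧ tv z l < ev A (yv z) with hS₀
  have hmem : ∀ l : Fin (n + 1), l ∈ S₀ ↔ r ≤ (l : ℕ) ∧ tv z l < ev A (yv z) := fun l => by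
    rw [hS₀, Finset.mem_filter]; exact ⟨fun h => h.2, fun h => ⟨Finset.mem_univ _, h⟩⟩
  have hS : S₀.Nonempty := ⟨⟨r, hr⟩, (hmem _).2 ⟨le_rfl, hlt⟩⟩
  set q : Fin (n + 1) := S₀.max' hS with hqdef
  obtain ⟨hrq, hqA⟩ := (hmem q).1 (Finset.max'_mem S₀ hS)
  have hmax : ∀ l : Fin (n + 1), r ≤ (l : ℕ) → tv z l < ev A (yv z) → l ≤ q := fun l h1 h2 =>
    Finset.le_max' S₀ l ((hmem l).2 ⟨h1, h2⟩)
  refine ⟨(q : ℕ) + 1, by omega, by omega, ?_⟩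
  rw [Nat.add_sub_cancel]
  rw [jDom, mem_bdom] at hz ⊢
  obtain ⟨hy, h0, hn, h⟩ := hz
  refine ⟨hy, ?_, ?_, fun j => ⟨fun hj => ?_, fun hj => (h j).2 fun hh => hj (Finset.mem_insert_of_mem hh)⟩⟩
  · rw [jU_of_lt (show ((0 : Fin (n + 1)) : ℕ) < (q : ℕ) + 1 by simp only [Fin.val_zero]; omega)]
    rwa [jU_of_lt (show ((0 : Fin (n + 1)) : ℕ) < n + 1 from Nat.succ_pos n)] at h0
  · by_cases hqn : ((Fin.last n : Fin (n + 1)) : ℕ) < (q : ℕ) + 1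
    · rw [jV_of_lt hqn]
      have : Fin.last n = q := Fin.ext (by rw [Fin.val_last] at hqn ⊢; have := q.isLt; omega)
      rw [this]; exact hqA
    · rw [jV_of_le (not_lt.1 hqn)]
      rwa [jV_of_le (show r ≤ ((Fin.last n : Fin (n + 1)) : ℕ) by rw [Fin.val_last]; omega)] at hn
  · rcases Finset.mem_insert.1 hj with hjq | hjc
    · -- the new cut below `q + 1`
      have hcs : j.castSucc = q := Fin.ext (by rw [Fin.val_castSucc]; exact hjq)
      rw [jV_of_lt (show ((j.castSucc : Fin (n + 1)) : ℕ) < (q : ℕ) + 1 by rw [Fin.val_castSucc]; omega),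
        jU_of_le (show (q : ℕ) + 1 ≤ ((j.succ : Fin (n + 1)) : ℕ) by rw [Fin.val_succ]; omega), hcs]
      refine ⟨hqA, lt_of_le_of_ne (not_lt.1 fun hlt' => ?_) (hne _).symm⟩
      have := hmax j.succ (by rw [Fin.val_succ]; omega) hlt'
      rw [Fin.le_def, Fin.val_succ] at this
      omega
    · -- an old cut
      have hjr : (j : ℕ) < r := hc _ hjc
      obtain ⟨h1, h2⟩ := (h j).1 hjc
      rw [jV_of_lt (show ((j.castSucc : Fin (n + 1)) : ℕ) < r by rw [Fin.val_castSucc]; exact hjr)] at h1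
      rw [jU_of_lt (j.succ).isLt] at h2
      rw [jV_of_lt (show ((j.castSucc : Fin (n + 1)) : ℕ) < (q : ℕ) + 1 by rw [Fin.val_castSucc]; omega),
        jU_of_lt (show ((j.succ : Fin (n + 1)) : ℕ) < (q : ℕ) + 1 by rw [Fin.val_succ]; omega)]
      exact ⟨h1, h2⟩

/-- **The position cells are pairwise disjoint**: the pinched cell has `A < tᵣ`, a deeper cell
with threshold `r' > r` has `tᵣ ≤ t_{r'−1} < A`. -/
theorem not_mem_piece_of_mem (hTA : ∀ y ∈ cell M, ev T₀ y ≤ ev A y) {c : Finset ℕ} {r : ℕ} (hr : r < n + 1)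
    (hc : ∀ j ∈ c, j < r) (hcr : ∀ j : Fin n, (j : ℕ) + 1 = r → (j : ℕ) ∈ c)
    {z : Fin (0 + 1 + (n + 1)) → ℝ} (hz : z ∈ jDom M c T₀ A Bd r r) {r' : ℕ} (hrr' : r < r')
    (hr' : r' ≤ n + 1) (hz' : z ∈ jDom M (insert (r' - 1) c) T₀ A Bd r' r') : False := by
  have hA := ((mem_jDom_iff hTA hr hc hcr z).1 hz).2
  have hq := lt_A_of_mem_piece (by omega) hr' hz'
  have hmono : tv z ⟨r, hr⟩ ≤ tv z ⟨r' - 1, by omega⟩ := by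
    rcases (show r = r' - 1 ∨ r < r' - 1 by omega) with h | h
    · exact le_of_eq (by subst h; rfl)
    · refine le_of_lt (lt_of_uncut hz' (u := ⟨r, hr⟩) (v := ⟨r' - 1, by omega⟩) (fun j h1 h2 hj => ?_)
        le_rfl (Fin.lt_def.2 h) le_rfl)
      rcases Finset.mem_insert.1 hj with h3 | h3
      · exact absurd h3 (by simp only at h2; omega)
      · exact absurd (hc _ h3) (by simp only at h1; omega)
  exact lt_irrefl _ ((hA.trans_le hmono).trans hq)

/-- **Two deeper cells are disjoint**: thresholds `r < r' < r''` give `A < t_{r'} ≤ t_{r''−1} < A`. -/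
theorem not_mem_piece_piece (hTA : ∀ y ∈ cell M, ev T₀ y ≤ ev A y) {c : Finset ℕ} {r : ℕ}
    (hc : ∀ j ∈ c, j < r) {r' r'' : ℕ} (hrr' : r < r') (hr'r'' : r' < r'') (hr'' : r'' ≤ n + 1)
    {z : Fin (0 + 1 + (n + 1)) → ℝ} (hz' : z ∈ jDom M (insert (r' - 1) c) T₀ A Bd r' r')
    (hz'' : z ∈ jDom M (insert (r'' - 1) c) T₀ A Bd r'' r'') : False := by
  have hr' : r' < n + 1 := by omega
  have hA := ((mem_jDom_iff hTA hr' (fun j hj => ?_) (fun j hj => ?_) z).1 hz').2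
  rotate_left
  · rcases Finset.mem_insert.1 hj with h | h
    · omega
    · exact (hc _ h).trans hrr'
  · rw [← hj, Nat.add_sub_cancel]; exact Finset.mem_insert_self _ _
  have hq := lt_A_of_mem_piece (by omega) hr'' hz''
  have hmono : tv z ⟨r', hr'⟩ ≤ tv z ⟨r'' - 1, by omega⟩ := by
    rcases (show r' = r'' - 1 ∨ r' < r'' - 1 by omega) with h | h
    · exact le_of_eq (by subst h; rfl)
    · refine le_of_lt (lt_of_uncut hz' (u := ⟨r', hr'⟩) (v := ⟨r'' - 1, by omega⟩) (fun j h1 h2 hj => ?_)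
        le_rfl (Fin.lt_def.2 h) le_rfl)
      rcases Finset.mem_insert.1 hj with h3 | h3
      · simp only at h1; omega
      · exact absurd (hc _ h3) (by simp only at h1; omega)
  exact lt_irrefl _ ((hA.trans_le hmono).trans hq)

end RebaseChain

/-- Registered support goal of this file (part of `rebaseSimpleZeroMany_common`): the position
cells of the sub-section Janus cover the unpinched cell up to the ties `tₗ = A`
(`RebaseChain.mem_cover`). -/
theorem rebaseSimpleZeroMany_janusCover (n m' : ℕ) (M : Fin m' → (Fin (0 + 1) → ℚ) × ℚ) (T₀ A Bd : (Fin (0 + 1) → ℚ) × ℚ) (hTA : ∀ y ∈ RebaseZero.cell M, RebaseZero.ev T₀ y ≤ RebaseZero.ev A y) (c : Finset ℕ) (r : ℕ) (hr : r < n + 1) (hc : ∀ j ∈ c, j < r) (hcr : ∀ j : Fin n, (j : ℕ) + 1 = r → (j : ℕ) ∈ c) (z : Fin (0 + 1 + (n + 1)) → ℝ) (hz : z ∈ RebaseChain.jDom M c T₀ A Bd (n + 1) r) (hne : ∀ l, RebaseZero.tv z l ≠ RebaseZero.ev A (RebaseZero.yv z)) : z ∈ RebaseChain.jDom M c T₀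 A Bd r r ∨ ∃ r', r < r' ∧ r' ≤ n + 1 ∧ z ∈ RebaseChain.jDom M (insert (r' - 1) c) T₀ A Bd r' r' :=
  RebaseChain.mem_cover hTA hr hc hcr hz hne

end Summit.KontsevichZagierPeriods.ArrangementNormalForm.JanusBands
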